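import Summits.PneNP.PneNP.Theorems.SymmetryBudgetNoHiddenOrderWindowLabels

/-!
# `NoHiddenOrder` (stmt-PneNP-14781): the label index TYPES of the compiler and the relabelling action on them

Route `PneNP/SymmetryBudget`; continues `…WindowLabels.lean`.  A symmetric program indexes its gate groups by a finite TYPE of labels and
its symmetry data `θ ρ` permute that type.  This file turns the finite sets `admLabels B` / `windowLabels W B` into such types and supplies
the action:

* `admB_of_mem_budgetCover`, `mem_admLabels_iff`, `mem_windowLabels_iff` — the covers contain EXACTLY the admissible labels (so the
  subtypes below are literally "the admissible labels");
* `CertifiedLabels.Label.relabel σ L = (σ U, σ X, λ ∘ σ⁻¹)` with `relabelEquiv`, and its bookkeeping against the scheme's label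
  constructors: `relabel_part`, `relabel_cand`, `measure_relabel`;
* `AdmLabel V B = {L // AdmB B L.X L.λ}` (process on the window type): `Fintype` (through `admLabels`), `card_admLabel_le_pow`
  (`≤ m^18` on `↥(windowSet m)` at the window budget), and the permutation `AdmLabel.relabel σ` of it induced by any `σ : Perm V`
  (`admB_relabel`);
* `WLabel W B = {L // U ⊆ W ∧ X ⊆ W ∧ AdmB B X λ}` (process on `Fin m` from the window): `Fintype`, `card_wLabel_le_pow`, and
  `WLabel.relabel` for permutations preserving `W` (every `ρ ∈ Bud` does: it fixes `Wᶜ` pointwise).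
Sorry-free; supports stmt-PneNP-14781, does not close it.
-/

set_option linter.dupNamespace false -- `Summit.PneNP.PneNP.…` (D-0017 single-conjunct layout)

namespace Summit.PneNP.PneNP.Theorems

open Finset Literature.Computability.Complexity
open Summit.PneNP.PneNP.Theses.SymmetryBudget

/-! ### The covers contain exactly the admissible labels -/

namespace BranchSum

variable {V : Type*} [Fintype V] [DecidableEq V]

/-- **Members of the cover are admissible**: decoding `(X, p, o)` with `Σ p ≤ B`, `o < 2^p` gives `λ = 2^p + o - 1` on `X` (bit-length `p`)
and `0` off `X`. -/
theorem admB_of_mem_budgetCover {B : ℕ} {X : Finset V} {lam : V → ℕ} (h : (X, lam) ∈ budgetCover V B) : AdmB B X lam := by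
  unfold budgetCover at h
  rw [mem_image] at h
  obtain ⟨⟨X', p, o⟩, hq, hEq⟩ := h
  simp only [Prod.mk.injEq] at hEq
  obtain ⟨rfl, rfl⟩ := hEq
  rw [mem_product, mem_sigma] at hq
  obtain ⟨-, hp, ho⟩ := hq
  dsimp only at hp ho
  unfold profiles at hp
  rw [mem_filter] at hp
  rw [Fintype.mem_piFinset] at ho
  refine ⟨fun y hy => by simp [decodeLam, hy], ?_⟩
  -- on `X'` the bit-length of `2^{p y} + o y - 1 + 1` is `p y`
  have hlog : ∀ y ∈ X', Nat.log 2 (decodeLam X' p o y + 1) = p y := by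
    intro y hy
    have hoy : o y < 2 ^ p y := mem_range.1 (ho y)
    have h1 : 1 ≤ 2 ^ p y := Nat.one_le_two_pow
    have hval : decodeLam X' p o y + 1 = 2 ^ p y + o y := by simp [decodeLam, hy]; omega
    rw [hval]
    refine Nat.log_eq_of_pow_le_of_lt_pow (Nat.le_add_right _ _) ?_
    rw [pow_succ]; omega
  calc ∑ y ∈ X', Nat.log 2 (decodeLam X' p o y + 1) = ∑ y ∈ X', p y := sum_congr rfl hlog
    _ ≤ ∑ y, p y := sum_le_sum_of_subset_of_nonneg (subset_univ _) fun _ _ _ => Nat.zero_le _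
    _ ≤ B := hp.2

/-- **`admLabels B` is exactly the set of admissible labels.** -/
theorem mem_admLabels_iff {B : ℕ} {L : CertifiedLabels.Label V} : L ∈ admLabels B ↔ AdmB B L.X L.lam := by
  refine ⟨fun h => ?_, mem_admLabels⟩
  unfold admLabels at h
  rw [mem_image] at h
  obtain ⟨⟨U, X, lam⟩, hq, rfl⟩ := h
  exact admB_of_mem_budgetCover (mem_product.1 hq).2

omit [Fintype V] in
/-- The extension by zero vanishes outside the window. -/
theorem extendFun_of_not_mem {W : Finset V} (f : ↥W → ℕ) {v : V} (hv : v ∉ W) : extendFun W f v = 0 := by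
  simp [extendFun, hv]

omit [Fintype V] in
/-- The extension by zero agrees with `f` on the window. -/
@[simp] theorem extendFun_apply {W : Finset V} (f : ↥W → ℕ) (u : ↥W) : extendFun W f u = f u := by
  obtain ⟨u, hu⟩ := u
  simp [extendFun, hu]

/-- **`windowLabels W B` is exactly the set of admissible labels inside the window.** -/
theorem mem_windowLabels_iff {W : Finset V} {B : ℕ} {L : CertifiedLabels.Label V} :
    L ∈ windowLabels W B ↔ L.U ⊆ W ∧ L.X ⊆ W ∧ AdmB B L.X L.lam := by
  refine ⟨fun h => ?_, fun h => mem_windowLabels h.1 h.2.1 h.2.2⟩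
  unfold windowLabels at h
  rw [mem_image] at h
  obtain ⟨⟨U, X', lam'⟩, hq, rfl⟩ := h
  rw [mem_product] at hq
  obtain ⟨hU, hc⟩ := hq
  have hA := admB_of_mem_budgetCover hc
  refine ⟨mem_powerset.1 hU, fun v hv => ?_, fun v hv => ?_, ?_⟩
  · obtain ⟨u, -, rfl⟩ := mem_map.1 hv
    exact u.2
  · show extendFun W lam' v = 0
    by_cases hvW : v ∈ W
    · have hu : (⟨v, hvW⟩ : ↥W) ∉ X' := fun hu => hv (mem_map.2 ⟨⟨v, hvW⟩, hu, rfl⟩)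
      simpa [extendFun, hvW] using hA.1 _ hu
    · exact extendFun_of_not_mem _ hvW
  · show ∑ y ∈ X'.map (Function.Embedding.subtype _), Nat.log 2 (extendFun W lam' y + 1) ≤ B
    rw [sum_map]
    simp only [Function.Embedding.coe_subtype, extendFun_apply]
    exact hA.2

end BranchSum

/-! ### The relabelling action on labels -/

namespace CertifiedLabels.Label

variable {W : Type*}

/-- **Relabelling a label along a permutation of the vertices**: `σ · (U, X, λ) = (σ U, σ X, λ ∘ σ⁻¹)`. -/
def relabel (σ : Equiv.Perm W) (L : Label W) : Label W := ⟨L.U.map σ.toEmbedding, L.X.map σ.toEmbedding, L.lam ∘ σ.symm⟩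

/-- The block of a relabelled label. -/
@[simp] theorem relabel_U (σ : Equiv.Perm W) (L : Label W) : (L.relabel σ).U = L.U.map σ.toEmbedding := rfl
/-- The named set of a relabelled label. -/
@[simp] theorem relabel_X (σ : Equiv.Perm W) (L : Label W) : (L.relabel σ).X = L.X.map σ.toEmbedding := rfl
/-- The values of a relabelled label. -/
@[simp] theorem relabel_lam (σ : Equiv.Perm W) (L : Label W) : (L.relabel σ).lam = L.lam ∘ σ.symm := rfl

/-- Relabelling by `σ⁻¹` undoes relabelling by `σ`. -/
theorem relabel_symm_relabel (σ : Equiv.Perm W) (L : Label W) : (L.relabel σ).relabel σ.symm = L := by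
  obtain ⟨U, X, lam⟩ := L
  simp only [relabel, Label.mk.injEq]
  refine ⟨?_, ?_, ?_⟩
  · ext v; simp [Finset.mem_map_equiv]
  · ext v; simp [Finset.mem_map_equiv]
  · funext v; simp

/-- Relabelling by `σ` undoes relabelling by `σ⁻¹`. -/
theorem relabel_relabel_symm (σ : Equiv.Perm W) (L : Label W) : (L.relabel σ.symm).relabel σ = L := by
  simpa using relabel_symm_relabel σ.symm L

/-- **Relabelling is a permutation of the labels.** -/
def relabelEquiv (σ : Equiv.Perm W) : Label W ≃ Label W where
  toFun := relabel σ
  invFun := relabel σ.symm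
  left_inv := relabel_symm_relabel σ
  right_inv := relabel_relabel_symm σ

/-- `relabelEquiv` is `relabel`. -/
@[simp] theorem relabelEquiv_apply (σ : Equiv.Perm W) (L : Label W) : relabelEquiv σ L = L.relabel σ := rfl

/-- **Relabelling commutes with taking a part label**: `σ · (L.part U') = (σ · L).part (σ U')`. -/
theorem relabel_part (σ : Equiv.Perm W) (L : Label W) (U' : Finset W) :
    (L.part U').relabel σ = (L.relabel σ).part (U'.map σ.toEmbedding) := rfl

/-- **Relabelling commutes with taking a candidate label**: `σ · (L.cand x v) = (σ · L).cand (σ x) v`. -/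
theorem relabel_cand [DecidableEq W] (σ : Equiv.Perm W) (L : Label W) (x : W) (v : ℕ) :
    (L.cand x v).relabel σ = (L.relabel σ).cand (σ x) v := by
  simp only [relabel, cand, Finset.map_insert, Equiv.coe_toEmbedding, Label.mk.injEq, true_and]
  funext y
  simp only [Function.comp_apply, Function.update_apply, Equiv.symm_apply_eq]

/-- Relabelling preserves the syntactic measure (so the relabelled program has the same acyclicity ranks). -/
theorem measure_relabel [Fintype W] (σ : Equiv.Perm W) (L : Label W) : (L.relabel σ).measure = L.measure := by
  simp [measure, relabel, Finset.card_map]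

end CertifiedLabels.Label

/-! ### The admissible labels as a finite type, and the action on it -/

namespace BranchSum

/-- **The ADMISSIBLE LABELS at budget `B`** as a type (process on the window type). -/
abbrev AdmLabel (V : Type*) [Fintype V] [DecidableEq V] (B : ℕ) : Type _ := {L : CertifiedLabels.Label V // AdmB B L.X L.lam}

variable {V : Type*} [Fintype V] [DecidableEq V]

/-- Finitely many admissible labels (through the cover `admLabels B`). -/
noncomputable instance instFintypeAdmLabel (B : ℕ) : Fintype (AdmLabel V B) :=
  Fintype.subtype (admLabels B) fun _ => mem_admLabels_iff

/-- The number of admissible labels is the size of the cover. -/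
theorem card_admLabel (B : ℕ) : Fintype.card (AdmLabel V B) = (admLabels (V := V) B).card :=
  Fintype.card_of_subtype (admLabels B) fun _ => mem_admLabels_iff

/-- **Polynomially many admissible labels on the window type**: `≤ m^18` on `↥(windowSet m)` at the window budget (`m ≥ 1`). -/
theorem card_admLabel_le_pow {m : ℕ} (hm : 0 < m) :
    Fintype.card (AdmLabel ↥(windowSet m) (4 * Fintype.card ↥(windowSet m) + Nat.log 2 (Fintype.card ↥(windowSet m)))) ≤ m ^ 18 := by
  rw [card_admLabel]
  exact card_admLabels_windowSet_le hm

omit [Fintype V] [DecidableEq V] in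
/-- Relabelling preserves admissibility (labels form). -/
theorem admB_relabel_label (σ : Equiv.Perm V) {B : ℕ} {L : CertifiedLabels.Label V} :
    AdmB B (L.relabel σ).X (L.relabel σ).lam ↔ AdmB B L.X L.lam :=
  admB_relabel σ

/-- **The permutation of the admissible labels induced by a permutation of the vertices** (the `θ ρ` of the compiler on label indices). -/
def AdmLabel.relabel (B : ℕ) (σ : Equiv.Perm V) : Equiv.Perm (AdmLabel V B) :=
  (CertifiedLabels.Label.relabelEquiv σ).subtypeEquiv fun _ => (admB_relabel_label σ).symm

/-- The underlying label of a relabelled admissible label. -/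
@[simp] theorem AdmLabel.coe_relabel {B : ℕ} (σ : Equiv.Perm V) (L : AdmLabel V B) :
    (AdmLabel.relabel B σ L : CertifiedLabels.Label V) = L.1.relabel σ :=
  rfl

/-- The inverse permutation is relabelling by `σ⁻¹`. -/
@[simp] theorem AdmLabel.coe_relabel_symm {B : ℕ} (σ : Equiv.Perm V) (L : AdmLabel V B) :
    ((AdmLabel.relabel B σ).symm L : CertifiedLabels.Label V) = L.1.relabel σ.symm := rfl

/-! ### The window labels as a finite type (process on `Fin m` from the window) -/

/-- **The WINDOW LABELS at budget `B`** as a type: `U, X ⊆ W` and admissible. -/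
abbrev WLabel (W : Finset V) (B : ℕ) : Type _ := {L : CertifiedLabels.Label V // L.U ⊆ W ∧ L.X ⊆ W ∧ AdmB B L.X L.lam}

/-- Finitely many window labels (through the cover `windowLabels W B`). -/
noncomputable instance instFintypeWLabel (W : Finset V) (B : ℕ) : Fintype (WLabel W B) :=
  Fintype.subtype (windowLabels W B) fun _ => mem_windowLabels_iff

/-- The number of window labels is the size of the cover. -/
theorem card_wLabel (W : Finset V) (B : ℕ) : Fintype.card (WLabel W B) = (windowLabels W B).card :=
  Fintype.card_of_subtype (windowLabels W B) fun _ => mem_windowLabels_iff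

/-- **Polynomially many window labels**: `≤ m^18` for `W = windowSet m` at the window budget (`m ≥ 1`). -/
theorem card_wLabel_le_pow {m : ℕ} (hm : 0 < m) :
    Fintype.card (WLabel (windowSet m) (4 * (windowSet m).card + Nat.log 2 (windowSet m).card)) ≤ m ^ 18 := by
  rw [card_wLabel]
  exact card_windowLabels_windowSet_le hm

omit [Fintype V] [DecidableEq V] in
/-- A permutation preserving the window maps subsets of the window to subsets of the window. -/
theorem map_subset_of_preserves {W : Finset V} {σ : Equiv.Perm V} (hσ : ∀ v, σ v ∈ W ↔ v ∈ W) {S : Finset V} (hS : S ⊆ W) :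
    S.map σ.toEmbedding ⊆ W := by
  intro v hv
  obtain ⟨u, hu, rfl⟩ := mem_map.1 hv
  exact (hσ u).2 (hS hu)

omit [Fintype V] [DecidableEq V] in
/-- Relabelling by a window-preserving permutation preserves window labels. -/
theorem wLabel_relabel_iff {W : Finset V} {B : ℕ} {σ : Equiv.Perm V} (hσ : ∀ v, σ v ∈ W ↔ v ∈ W) (L : CertifiedLabels.Label V) :
    ((L.relabel σ).U ⊆ W ∧ (L.relabel σ).X ⊆ W ∧ AdmB B (L.relabel σ).X (L.relabel σ).lam) ↔ (L.U ⊆ W ∧ L.X ⊆ W ∧ AdmB B L.X L.lam) := by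
  rw [admB_relabel_label]
  constructor
  · rintro ⟨hU, hX, hA⟩
    refine ⟨fun u hu => ?_, fun u hu => ?_, hA⟩
    · exact (hσ u).1 (hU (mem_map.2 ⟨u, hu, rfl⟩))
    · exact (hσ u).1 (hX (mem_map.2 ⟨u, hu, rfl⟩))
  · rintro ⟨hU, hX, hA⟩
    exact ⟨map_subset_of_preserves hσ hU, map_subset_of_preserves hσ hX, hA⟩

/-- **The permutation of the window labels induced by a window-preserving permutation** (every `ρ ∈ Bud(m,⌊log₂ m⌋)` preserves `windowSet m`,
since it fixes its complement pointwise). -/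
def WLabel.relabel {W : Finset V} (B : ℕ) {σ : Equiv.Perm V} (hσ : ∀ v, σ v ∈ W ↔ v ∈ W) : Equiv.Perm (WLabel W B) :=
  (CertifiedLabels.Label.relabelEquiv σ).subtypeEquiv fun L => (wLabel_relabel_iff hσ L).symm

omit [Fintype V] [DecidableEq V] in
/-- The underlying label of a relabelled window label. -/
@[simp] theorem WLabel.coe_relabel {W : Finset V} {B : ℕ} {σ : Equiv.Perm V} (hσ : ∀ v, σ v ∈ W ↔ v ∈ W) (L : WLabel W B) :
    (WLabel.relabel B hσ L : CertifiedLabels.Label V) = L.1.relabel σ := rfl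

/-- **Budget permutations preserve the window.** -/
theorem windowSet_preserved_of_mem_budget {m : ℕ} {ρ : Equiv.Perm (Fin m)} (hρ : ρ ∈ pointStabiliserBudget m (Nat.log 2 m)) (v : Fin m) :
    ρ v ∈ windowSet m ↔ v ∈ windowSet m := by
  rw [mem_pointStabiliserBudget_iff] at hρ
  by_cases hv : v ∈ windowSet m
  · refine ⟨fun _ => hv, fun _ => ?_⟩
    by_contra hρv
    -- `ρ v` is ordered, hence fixed by `ρ`; injectivity forces `v = ρ v`, contradiction
    have hfix : ρ (ρ v) = ρ v := hρ _ (by rw [mem_windowSet_iff, not_not] at hρv; exact hρv)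
    rw [ρ.injective hfix] at hρv
    exact hρv hv
  · have hfix : ρ v = v := hρ _ (by rw [mem_windowSet_iff, not_not] at hv; exact hv)
    rw [hfix]

end BranchSum

end Summit.PneNP.PneNP.Theorems
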